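import Summits.HodgeConjecture.HodgeConjecture.Theorems.CYFormCasimirCYFormSquarePrincipleGraph
import HarnessLib

/-!
# Crux X3 `CYFormSquarePrinciple` (route `CYFormCasimir`, stmt-HodgeConjecture-23494), helper file 4b:
# the rational operator `q((𝟙 + 2φ)^*)` projecting `H⁴(A(ℂ); ℂ)` onto `⋀⁴W ⊕ ⋀⁴W^*`

research route conditional on HC_CM; not a corollary. Nothing here proves HC, HC_CM or any rung.

With `z = 2i√d`, `α = 1 + z`, `β = 1 - z`, `u = αβ = 1 + 4d`, the test pull-back `Ψ = (𝟙 + 2φ)^*` acts on the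
summand `⋀ᵃW ⊗ ⋀ᵇW^*` of `H⁴(A(ℂ); ℂ)` (`a + b = 4`) by `αᵃβᵇ` (helper file 2). The INTEGER polynomial
`q(X) = (X - u²)(X² - 2u(1 - 4d)X + u⁴) = (X - α²β²)(X - α³β)(X - αβ³)` kills the three mixed summands and is
non-zero at `α⁴`, `β⁴` (`testPoly_*`); hence `Q = q(Ψ)` maps `H⁴` onto `⋀⁴W ⊕ ⋀⁴W^*`
(`testPolyOp_mem_sup`, `exists_testPolyOp_eq_of_mem_sup`), preserves rational classes and Hodge types
(`isRationalClass_testPolyOp`, `testPolyOp_mem_typePiece`). This is the rational, Hodge-theoretic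
replacement for the (irrational) eigen-projector onto `⋀⁴W ⊕ ⋀⁴W^*` used to build the Hodge projector onto
the CY form `T` in helper file 4c.

References: vanGeemen1994HodgeAV (4.9, proof of Thm. 6.12), FriedmanLaza2013 (§3.5 Prop. 37).
-/

-- `Summit.HodgeConjecture.HodgeConjecture.…` is the tree's mandated summit/problem namespace (single-problem summit).
set_option linter.dupNamespace false
noncomputable section

open CategoryTheory
open Literature.AlgebraicTopology.SingularHomology
open Literature.AlgebraicGeometry.Motives
open Literature.AlgebraicGeometry.HodgeTheory
open Literature.AlgebraicGeometry.VanGeemen1994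

namespace Summit.HodgeConjecture.HodgeConjecture.Theorems.CYFormSquare

/-! ### Numerics of the test polynomial -/

section Numerics

variable {d : ℕ}

/-- `αβ = 1 + 4d` for `α = 1 + 2i√d`, `β = 1 - 2i√d`. [folklore] -/
theorem testChar_mul (d : ℕ) :
    (1 + 2 * Complex.I * (Real.sqrt d : ℂ)) * (1 - 2 * Complex.I * (Real.sqrt d : ℂ)) = 1 + 4 * (d : ℂ) := by
  linear_combination (-1 : ℂ) * two_I_sqrt_sq d

/-- The quadratic factor of the test polynomial splits: `X² - 2u(1-4d)X + u⁴ = (X - uα²)(X - uβ²)`, `u = 1 + 4d`.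
[folklore] -/
theorem testPoly_quadratic_eq (d : ℕ) (X : ℂ) :
    X ^ 2 - 2 * (1 + 4 * (d : ℂ)) * (1 - 4 * (d : ℂ)) * X + (1 + 4 * (d : ℂ)) ^ 4 =
      (X - (1 + 4 * (d : ℂ)) * (1 + 2 * Complex.I * (Real.sqrt d : ℂ)) ^ 2) *
        (X - (1 + 4 * (d : ℂ)) * (1 - 2 * Complex.I * (Real.sqrt d : ℂ)) ^ 2) := by
  have hz2 := two_I_sqrt_sq d
  have hab := testChar_mul d
  set z : ℂ := 2 * Complex.I * (Real.sqrt d : ℂ) with hz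
  set u : ℂ := 1 + 4 * (d : ℂ) with hu
  have hsum : u * (1 + z) ^ 2 + u * (1 - z) ^ 2 = 2 * u * (1 - 4 * (d : ℂ)) := by
    linear_combination (2 * u) * hz2
  have hprod : (u * (1 + z) ^ 2) * (u * (1 - z) ^ 2) = u ^ 4 := by
    rw [show (u * (1 + z) ^ 2) * (u * (1 - z) ^ 2) = u ^ 2 * ((1 + z) * (1 - z)) ^ 2 by ring, hab]; ring
  linear_combination X * hsum - hprod

/-- **The test polynomial kills the mixed characters**: for `a + b = 4`, `0 < a`, `0 < b`,
`q(αᵃβᵇ) = 0`, `q(X) = (X - u²)(X² - 2u(1-4d)X + u⁴)` (`αᵃβᵇ ∈ {uβ², u², uα²}`).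
[cite: vanGeemen1994HodgeAV, proof of Thm. 6.12] -/
theorem testPoly_mixed_eq_zero (d : ℕ) {a b : ℕ} (hab4 : a + b = 4) (ha : a ≠ 0) (hb : b ≠ 0) :
    ((1 + 2 * Complex.I * (Real.sqrt d : ℂ)) ^ a * (1 - 2 * Complex.I * (Real.sqrt d : ℂ)) ^ b - (1 + 4 * (d : ℂ)) ^ 2) *
      (((1 + 2 * Complex.I * (Real.sqrt d : ℂ)) ^ a * (1 - 2 * Complex.I * (Real.sqrt d : ℂ)) ^ b) ^ 2 -
        2 * (1 + 4 * (d : ℂ)) * (1 - 4 * (d : ℂ)) *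
          ((1 + 2 * Complex.I * (Real.sqrt d : ℂ)) ^ a * (1 - 2 * Complex.I * (Real.sqrt d : ℂ)) ^ b) +
        (1 + 4 * (d : ℂ)) ^ 4) = 0 := by
  have hab := testChar_mul d
  set α : ℂ := 1 + 2 * Complex.I * (Real.sqrt d : ℂ) with hα
  set β : ℂ := 1 - 2 * Complex.I * (Real.sqrt d : ℂ) with hβ
  rw [testPoly_quadratic_eq d, ← hab]
  have ha3 : a ≤ 3 := by omega
  interval_cases a
  · omega
  · obtain rfl : b = 3 := by omega
    have : α ^ 1 * β ^ 3 - α * β * β ^ 2 = 0 := by ring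
    rw [this]; ring
  · obtain rfl : b = 2 := by omega
    have : α ^ 2 * β ^ 2 - (α * β) ^ 2 = 0 := by ring
    rw [this]; ring
  · obtain rfl : b = 1 := by omega
    have : α ^ 3 * β ^ 1 - α * β * α ^ 2 = 0 := by ring
    rw [this]; ring

/-- **The test polynomial does not vanish at `α⁴`** (`d ≥ 1`):
`q(α⁴) = α²(α² - β²) · α³(α - β) · α(α³ - β³) ≠ 0`. [cite: vanGeemen1994HodgeAV, proof of Thm. 6.12] -/
theorem testPoly_plus_ne_zero (hd : 0 < d) :
    ((1 + 2 * Complex.I * (Real.sqrt d : ℂ)) ^ 4 - (1 + 4 * (d : ℂ)) ^ 2) *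
      (((1 + 2 * Complex.I * (Real.sqrt d : ℂ)) ^ 4) ^ 2 -
        2 * (1 + 4 * (d : ℂ)) * (1 - 4 * (d : ℂ)) * (1 + 2 * Complex.I * (Real.sqrt d : ℂ)) ^ 4 +
        (1 + 4 * (d : ℂ)) ^ 4) ≠ 0 := by
  have hab := testChar_mul d
  set α : ℂ := 1 + 2 * Complex.I * (Real.sqrt d : ℂ) with hα
  set β : ℂ := 1 - 2 * Complex.I * (Real.sqrt d : ℂ) with hβ
  have hα0 : α ≠ 0 := one_add_two_I_sqrt_ne_zero d
  have h1 := one_add_pow_ne_one_sub_pow hd (m := 1) le_rfl (by norm_num)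
  have h2 := one_add_pow_ne_one_sub_pow hd (m := 2) (by norm_num) (by norm_num)
  have h3 := one_add_pow_ne_one_sub_pow hd (m := 3) (by norm_num) (by norm_num)
  rw [pow_one, pow_one] at h1
  rw [testPoly_quadratic_eq d, ← hab,
    show α ^ 4 - (α * β) ^ 2 = α ^ 2 * (α ^ 2 - β ^ 2) by ring,
    show α ^ 4 - α * β * α ^ 2 = α ^ 3 * (α - β) by ring,
    show α ^ 4 - α * β * β ^ 2 = α * (α ^ 3 - β ^ 3) by ring]
  exact mul_ne_zero (mul_ne_zero (pow_ne_zero _ hα0) (sub_ne_zero.2 h2))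
    (mul_ne_zero (mul_ne_zero (pow_ne_zero _ hα0) (sub_ne_zero.2 h1)) (mul_ne_zero hα0 (sub_ne_zero.2 h3)))

/-- **The test polynomial does not vanish at `β⁴`** (`d ≥ 1`). [cite: vanGeemen1994HodgeAV, proof of Thm. 6.12] -/
theorem testPoly_minus_ne_zero (hd : 0 < d) :
    ((1 - 2 * Complex.I * (Real.sqrt d : ℂ)) ^ 4 - (1 + 4 * (d : ℂ)) ^ 2) *
      (((1 - 2 * Complex.I * (Real.sqrt d : ℂ)) ^ 4) ^ 2 -
        2 * (1 + 4 * (d : ℂ)) * (1 - 4 * (d : ℂ)) * (1 - 2 * Complex.I * (Real.sqrt d : ℂ)) ^ 4 +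
        (1 + 4 * (d : ℂ)) ^ 4) ≠ 0 := by
  have hab := testChar_mul d
  set α : ℂ := 1 + 2 * Complex.I * (Real.sqrt d : ℂ) with hα
  set β : ℂ := 1 - 2 * Complex.I * (Real.sqrt d : ℂ) with hβ
  have hβ0 : β ≠ 0 := one_sub_two_I_sqrt_ne_zero d
  have h1 := one_add_pow_ne_one_sub_pow hd (m := 1) le_rfl (by norm_num)
  have h2 := one_add_pow_ne_one_sub_pow hd (m := 2) (by norm_num) (by norm_num)
  have h3 := one_add_pow_ne_one_sub_pow hd (m := 3) (by norm_num) (by norm_num)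
  rw [pow_one, pow_one] at h1
  rw [testPoly_quadratic_eq d, ← hab,
    show β ^ 4 - (α * β) ^ 2 = β ^ 2 * (β ^ 2 - α ^ 2) by ring,
    show β ^ 4 - α * β * α ^ 2 = β * (β ^ 3 - α ^ 3) by ring,
    show β ^ 4 - α * β * β ^ 2 = β ^ 3 * (β - α) by ring]
  exact mul_ne_zero (mul_ne_zero (pow_ne_zero _ hβ0) (sub_ne_zero.2 (Ne.symm h2)))
    (mul_ne_zero (mul_ne_zero hβ0 (sub_ne_zero.2 (Ne.symm h3))) (mul_ne_zero (pow_ne_zero _ hβ0) (sub_ne_zero.2 (Ne.symm h1))))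

/-- The coefficients of the test polynomial are rational. [folklore] -/
theorem testPoly_coeff_rat (d : ℕ) :
    (((((1 + 4 * d) ^ 2 : ℕ) : ℚ) : ℂ) = (1 + 4 * (d : ℂ)) ^ 2) ∧
      ((((2 * (1 + 4 * (d : ℤ)) * (1 - 4 * (d : ℤ)) : ℤ) : ℚ) : ℂ) = 2 * (1 + 4 * (d : ℂ)) * (1 - 4 * (d : ℂ))) ∧
      (((((1 + 4 * d) ^ 4 : ℕ) : ℚ) : ℂ) = (1 + 4 * (d : ℂ)) ^ 4) := by
  refine ⟨by push_cast; ring, by push_cast; ring, by push_cast; ring⟩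

end Numerics

/-! ### A polynomial in a linear operator on an eigenvector -/

/-- `(L - a)(L² - bL + c) v = (ε - a)(ε² - bε + c) v` for an eigenvector `L v = ε v`. [folklore] -/
theorem testPolyOp_apply_of_eigen {M : Type*} [AddCommGroup M] [Module ℂ M] (L : M →ₗ[ℂ] M) (a b c ε : ℂ)
    {v : M} (hv : L v = ε • v) :
    ((L - a • LinearMap.id) ∘ₗ (L ∘ₗ L - b • L + c • LinearMap.id)) v = ((ε - a) * (ε ^ 2 - b * ε + c)) • v := by
  simp only [LinearMap.comp_apply, LinearMap.sub_apply, LinearMap.add_apply, LinearMap.smul_apply, LinearMap.id_apply,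
    hv, map_smul, map_add, map_sub, smul_smul]
  module

/-! ### The operator `Q = q(Ψ)` on `H⁴(A(ℂ); ℂ)` of an eightfold -/

section TestPolyOp

variable {A : AbelianVariety ℂ} {d : ℕ} {φ : A ⟶ A}
variable (hn : 2 ≤ 4) (hd : 0 < d) (hA : A.dim = 2 * 4) (hφ : φ ≫ φ = -(d • 𝟙 A))
  (e : ProjectiveEmbedding A.X) {a : complexBetti (projectiveSpace e.n ℂ) 2} (ha : IsRationalClass a)
  (ha0 : a ≠ 0)
  (Q : complexBetti A.X (2 * 2) →ₗ[ℂ] complexBetti A.X (2 * 2))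
  (hQ : Q = ((complexBetti.map ((1 : ℕ) • 𝟙 A + (2 : ℕ) • φ).hom.hom.hom (2 * 2)).hom -
      ((1 + 4 * (d : ℂ)) ^ 2) • LinearMap.id) ∘ₗ
    ((complexBetti.map ((1 : ℕ) • 𝟙 A + (2 : ℕ) • φ).hom.hom.hom (2 * 2)).hom ∘ₗ
        (complexBetti.map ((1 : ℕ) • 𝟙 A + (2 : ℕ) • φ).hom.hom.hom (2 * 2)).hom -
      (2 * (1 + 4 * (d : ℂ)) * (1 - 4 * (d : ℂ))) • (complexBetti.map ((1 : ℕ) • 𝟙 A + (2 : ℕ) • φ).hom.hom.hom (2 * 2)).hom +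
      ((1 + 4 * (d : ℂ)) ^ 4) • LinearMap.id))

include hQ in
/-- `Q` on an eigenvector of `Ψ = (𝟙 + 2φ)^*`. [folklore] -/
theorem testPolyOp_apply {v : complexBetti A.X (2 * 2)} {ε : ℂ}
    (hv : complexBetti.map ((1 : ℕ) • 𝟙 A + (2 : ℕ) • φ).hom.hom.hom (2 * 2) v = ε • v) :
    Q v = ((ε - (1 + 4 * (d : ℂ)) ^ 2) * (ε ^ 2 - 2 * (1 + 4 * (d : ℂ)) * (1 - 4 * (d : ℂ)) * ε + (1 + 4 * (d : ℂ)) ^ 4)) • v := by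
  rw [hQ]
  exact testPolyOp_apply_of_eigen _ _ _ _ _ hv

include hn hd hA hφ e ha ha0 hQ in
/-- **`Q` maps `H⁴(A(ℂ); ℂ)` into `⋀⁴W ⊕ ⋀⁴W^*`**: on the monomial basis `Q b_s = q(αᵃβᵇ) b_s`, zero for mixed `s`,
while the pure monomials lie in `⋀⁴W`, `⋀⁴W^*`. [cite: vanGeemen1994HodgeAV, proof of Thm. 6.12] -/
theorem testPolyOp_mem_sup (v : complexBetti A.X (2 * 2)) :
    Q v ∈ weilClassesPlus A φ 2 d ⊔ weilClassesMinus A φ 2 d := by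
  classical
  set B := monB (bW hn hd hA hφ e ha ha0) (2 * 2) with hB
  rw [← B.sum_repr v, map_sum]
  refine Submodule.sum_mem _ fun s _ ↦ ?_
  rw [map_smul]
  refine Submodule.smul_mem _ _ ?_
  have hev := testOp_monB hn hd hA hφ e ha ha0 1 2 (2 * 2) s
  push_cast at hev
  rw [hB, testPolyOp_apply Q hQ hev]
  set p := (projW s.val).card with hp
  set q := (Finset.univ.filter fun j : Fin (2 * 4) ↦ Fin.natAdd (2 * 4) j ∈ s.val).card with hq
  have hpq : p + q = 4 := by rw [hp, hq, ← card_eq_card_projW_add]; exact s.prop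
  by_cases hq0 : q = 0
  · exact Submodule.smul_mem _ _ (Submodule.mem_sup_left (monB_mem_weilClassesPlus_two hn hd hA hφ e ha ha0 s hq0))
  by_cases hp0 : p = 0
  · exact Submodule.smul_mem _ _ (Submodule.mem_sup_right (monB_mem_weilClassesMinus_two hn hd hA hφ e ha ha0 s hp0))
  rw [testPoly_mixed_eq_zero d hpq hp0 hq0, zero_smul]
  exact Submodule.zero_mem _

include hQ in
/-- **`Q` is onto `⋀⁴W ⊕ ⋀⁴W^*`**: it acts there by the non-zero scalars `q(α⁴)`, `q(β⁴)`.
[cite: vanGeemen1994HodgeAV, proof of Thm. 6.12] -/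
theorem exists_testPolyOp_eq_of_mem_sup (hd : 0 < d) {r : complexBetti A.X (2 * 2)}
    (hr : r ∈ weilClassesPlus A φ 2 d ⊔ weilClassesMinus A φ 2 d) : ∃ v, Q v = r := by
  obtain ⟨x, hx, y, hy, rfl⟩ := Submodule.mem_sup.1 hr
  set α : ℂ := 1 + 2 * Complex.I * (Real.sqrt d : ℂ) with hα
  set β : ℂ := 1 - 2 * Complex.I * (Real.sqrt d : ℂ) with hβ
  set u : ℂ := 1 + 4 * (d : ℂ) with hu
  set qp : ℂ := (α ^ 4 - u ^ 2) * ((α ^ 4) ^ 2 - 2 * u * (1 - 4 * (d : ℂ)) * α ^ 4 + u ^ 4) with hqp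
  set qm : ℂ := (β ^ 4 - u ^ 2) * ((β ^ 4) ^ 2 - 2 * u * (1 - 4 * (d : ℂ)) * β ^ 4 + u ^ 4) with hqm
  have hqp0 : qp ≠ 0 := testPoly_plus_ne_zero hd
  have hqm0 : qm ≠ 0 := testPoly_minus_ne_zero hd
  have hx' : complexBetti.map ((1 : ℕ) • 𝟙 A + (2 : ℕ) • φ).hom.hom.hom (2 * 2) x = α ^ 4 • x := by
    have h := (mem_weilClassesPlus_iff.1 hx) 1 2; push_cast at h; exact h
  have hy' : complexBetti.map ((1 : ℕ) • 𝟙 A + (2 : ℕ) • φ).hom.hom.hom (2 * 2) y = β ^ 4 • y := by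
    have h := (mem_weilClassesMinus_iff.1 hy) 1 2; push_cast at h; exact h
  refine ⟨qp⁻¹ • x + qm⁻¹ • y, ?_⟩
  rw [map_add, map_smul, map_smul, testPolyOp_apply Q hQ hx', testPolyOp_apply Q hQ hy', smul_smul, smul_smul,
    ← hqp, ← hqm, inv_mul_cancel₀ hqp0, inv_mul_cancel₀ hqm0, one_smul, one_smul]

include hQ in
/-- **`Q` preserves rational classes** (pull-backs and rational combinations of rational classes).
[cite: HatcherAT2002, §3.1 p. 198] -/
theorem isRationalClass_testPolyOp {v : complexBetti A.X (2 * 2)} (hv : IsRationalClass v) : IsRationalClass (Q v) := by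
  obtain ⟨h2, h1, h4⟩ := testPoly_coeff_rat d
  have hΨ : ∀ w : complexBetti A.X (2 * 2), IsRationalClass w →
      IsRationalClass (complexBetti.map ((1 : ℕ) • 𝟙 A + (2 : ℕ) • φ).hom.hom.hom (2 * 2) w) :=
    fun w hw ↦ hw.pullback _
  have hsub : ∀ w w' : complexBetti A.X (2 * 2), IsRationalClass w → IsRationalClass w' → IsRationalClass (w - w') := by
    intro w w' hw hw'
    have h := hw.add (hw'.smul (-1))
    rwa [Rat.cast_neg, Rat.cast_one, neg_one_smul, ← sub_eq_add_neg] at h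
  rw [hQ]
  simp only [LinearMap.comp_apply, LinearMap.sub_apply, LinearMap.add_apply, LinearMap.smul_apply, LinearMap.id_apply]
  have hin : IsRationalClass
      ((complexBetti.map ((1 : ℕ) • 𝟙 A + (2 : ℕ) • φ).hom.hom.hom (2 * 2)).hom
          ((complexBetti.map ((1 : ℕ) • 𝟙 A + (2 : ℕ) • φ).hom.hom.hom (2 * 2)).hom v) -
        (2 * (1 + 4 * (d : ℂ)) * (1 - 4 * (d : ℂ))) • (complexBetti.map ((1 : ℕ) • 𝟙 A + (2 : ℕ) • φ).hom.hom.hom (2 * 2)).hom v +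
        ((1 + 4 * (d : ℂ)) ^ 4) • v) := by
    refine (hsub _ _ (hΨ _ (hΨ _ hv)) ?_).add ?_
    · rw [← h1]; exact (hΨ _ hv).smul _
    · rw [← h4]; exact hv.smul _
  refine hsub _ _ (hΨ _ hin) ?_
  rw [← h2]; exact hin.smul _

include hQ hA in
/-- **`Q` preserves the Hodge type pieces** (pull-backs along morphisms preserve Hodge types, and the type
pieces are subspaces). [cite: VoisinHodgeI2002, §7.3.2] -/
theorem testPolyOp_mem_typePiece (M : HodgeModel (2 * 4) A.X) (pq : ↥(Finset.HasAntidiagonal.antidiagonal (2 * 2)))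
    {v : complexBetti A.X (2 * 2)} (hv : v ∈ M.typePiece (2 * 2) pq) : Q v ∈ M.typePiece (2 * 2) pq := by
  have hX : IsSmoothProjective (2 * 4) A.X := isSmoothProjective_of_dim_eq' hA
  have hΨ : ∀ w ∈ M.typePiece (2 * 2) pq,
      (complexBetti.map ((1 : ℕ) • 𝟙 A + (2 : ℕ) • φ).hom.hom.hom (2 * 2)).hom w ∈ M.typePiece (2 * 2) pq :=
    fun w hw ↦ (M.mem_typePiece_iff_isOfHodgeType' hX pq _).2
      (((M.mem_typePiece_iff_isOfHodgeType' hX pq w).1 hw).map_of_isSmoothProjective hX hX _)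
  rw [hQ]
  simp only [LinearMap.comp_apply, LinearMap.sub_apply, LinearMap.add_apply, LinearMap.smul_apply, LinearMap.id_apply]
  have hin : (complexBetti.map ((1 : ℕ) • 𝟙 A + (2 : ℕ) • φ).hom.hom.hom (2 * 2)).hom
        ((complexBetti.map ((1 : ℕ) • 𝟙 A + (2 : ℕ) • φ).hom.hom.hom (2 * 2)).hom v) -
      (2 * (1 + 4 * (d : ℂ)) * (1 - 4 * (d : ℂ))) • (complexBetti.map ((1 : ℕ) • 𝟙 A + (2 : ℕ) • φ).hom.hom.hom (2 * 2)).hom v +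
      ((1 + 4 * (d : ℂ)) ^ 4) • v ∈ M.typePiece (2 * 2) pq :=
    Submodule.add_mem _ (Submodule.sub_mem _ (hΨ _ (hΨ _ hv)) (Submodule.smul_mem _ _ (hΨ _ hv)))
      (Submodule.smul_mem _ _ hv)
  exact Submodule.sub_mem _ (hΨ _ hin) (Submodule.smul_mem _ _ hin)

end TestPolyOp

end Summit.HodgeConjecture.HodgeConjecture.Theorems.CYFormSquare

end
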